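import Mathlib
import HarnessLib
import Summits.Ventures.LatticeQCDFlow.Scoring.ChainSampleAutocovariance
import Summits.Ventures.LatticeQCDFlow.Scoring.BlockSumLeadingBias

/-!
# Estimating the leading bias constant `Γ_f = Σ_{k≥1} k γ_k` from the run, from any start:
# `E_{μ₀} |Γ̂_{w,N} − Γ_f| ≤ w² ε(w, N) + 8C²A (w+1) ρ^{w+1}/(1−ρ)²`, `Γ̂_{w,N} = Σ_{k=1}^{w} k γ̂_{k,N}`

HONEST FRAMING: exact (Metropolis-corrected) sampling algorithms for lattice gauge theory;
figures of merit are autocorrelation/cost numbers at stated couplings and volumes; no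
continuum-physics claim.

Venture `LatticeQCDFlow` (cell pub-lqcd), topic `Scoring`; FANOUT row 4 (`s0-u1-b`, GEN-31).
NEW WORK of the cell, not a published result; no definition is introduced; nothing is cited as a
fact.  Setting of `Scoring/ChainSampleAutocovariance.lean` (kernel `κ`, invariant `π`, geometric
envelope `(A, ρ)` with `0 ≤ A`, `0 ≤ ρ < 1`, `|f| ≤ C` measurable, chain from ANY law `μ₀`,
`γ_k = autocov κ π f̄ k`, `|γ_k| ≤ 8C²Aρ^k`).  The constant `Γ_f = Σ' k, (k+1) γ_{k+1} = Σ_{k≥1} k γ_k`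
is the leading bias of the batch-means estimator (`σ̂²_{a,b}` is centred at `σ²_f − 2Γ_f/b`:
`Scoring/BatchMeansBiasIdentification.lean`, row 8's `Scoring/BlockSumLeadingBias.lean`).  The
truncated plug-in estimator from `N` samples with window `w`,
`Γ̂_{w,N} = Σ_{k<w} (k+1) γ̂_{k+1,N}`, `γ̂_{k,N} = (1/N) Σ_{i<N−k} (f(X_i) − m̂_N)(f(X_{i+k}) − m̂_N)`,
satisfies, for `2w ≤ N`, `0 < N`:
`E_{μ₀} |Γ̂_{w,N} − Γ_f| ≤ w² ε(w,N) + 8C²A (w+1) ρ^{w+1}/(1−ρ)²`,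
`ε(w,N) = √2 R_w/√N + 4C²w/N + 4C·D/√N + D²/N`, `R_w = 8C² (√(2w+1) + 2√10·A/(1−ρ))`,
`D = √10·4CA/(1−ρ)` — so `Γ̂_{w_N,N} → Γ_f` in `L¹` whenever `w_N → ∞` with `w_N^{5/2} = o(√N)`.

## Content

* `abs_tsum_shift_le_of_abs_le_geometric` — `|Σ' j, γ_{j+m}| ≤ K ρ^m/(1−ρ)`;
* `abs_leadingBias_tail_le` — `|Σ' k, (k+1) γ_{k+1} − Σ_{k<w} (k+1) γ_{k+1}| ≤ K (w+1) ρ^{w+1}/(1−ρ)²`;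
* `measurable_sampleAutocovariance`, `abs_sampleAutocovariance_le` (`|γ̂_{k,N}| ≤ 4C²`);
* **`chain_leadingBiasEstimator_abs_sub_le_of_envelope`** — the theorem in the title.

NOT CLAIMED: the choice of the window `w`; optimal constants; unbounded `f`; any number of ours.
-/

noncomputable section

namespace Summit.Ventures.LatticeQCDFlow.Scoring

open MeasureTheory ProbabilityTheory Filter Finset
open scoped ENNReal Topology

variable {Ω : Type*} [MeasurableSpace Ω]

/-! ### Series tails under a geometric bound -/

section Series

variable {γ : ℕ → ℝ} {K ρ : ℝ}

/-- `|γ_k| ≤ K ρ^k` (`0 ≤ ρ < 1`) ⇒ `|Σ' j, γ_{j+m}| ≤ K ρ^m/(1−ρ)`. -/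
theorem abs_tsum_shift_le_of_abs_le_geometric (hρ0 : 0 ≤ ρ) (hρ1 : ρ < 1)
    (hγ : ∀ k, |γ k| ≤ K * ρ ^ k) (m : ℕ) :
    |∑' j : ℕ, γ (j + m)| ≤ K * ρ ^ m / (1 - ρ) := by
  have hs := summable_of_abs_le_geometric hρ0 hρ1 hγ m
  have hmaj : HasSum (fun j : ℕ => K * ρ ^ m * ρ ^ j) (K * ρ ^ m * (1 - ρ)⁻¹) :=
    (hasSum_geometric_of_lt_one hρ0 hρ1).mul_left _
  calc |∑' j : ℕ, γ (j + m)| = ‖∑' j : ℕ, γ (j + m)‖ := (Real.norm_eq_abs _).symm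
    _ ≤ ∑' j : ℕ, ‖γ (j + m)‖ := norm_tsum_le_tsum_norm hs.norm
    _ ≤ ∑' j : ℕ, K * ρ ^ m * ρ ^ j := by
        refine Summable.tsum_le_tsum (fun j => ?_) hs.norm hmaj.summable
        rw [Real.norm_eq_abs]
        refine (hγ (j + m)).trans (le_of_eq ?_)
        rw [pow_add]; ring
    _ = K * ρ ^ m / (1 - ρ) := by rw [hmaj.tsum_eq, div_eq_mul_inv]

/-- **The tail of the leading-bias series**: `|γ_k| ≤ K ρ^k` (`0 ≤ ρ < 1`) ⇒ for every `w`,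
`|Σ' k, (k+1) γ_{k+1} − Σ_{k<w} (k+1) γ_{k+1}| ≤ K (w+1) ρ^{w+1}/(1−ρ)²`. -/
theorem abs_leadingBias_tail_le (hρ0 : 0 ≤ ρ) (hρ1 : ρ < 1) (hγ : ∀ k, |γ k| ≤ K * ρ ^ k) (w : ℕ) :
    |∑' k : ℕ, ((k : ℝ) + 1) * γ (k + 1) - ∑ k ∈ Finset.range w, ((k : ℝ) + 1) * γ (k + 1)|
      ≤ K * (w + 1) * ρ ^ (w + 1) / (1 - ρ) ^ 2 := by
  have h1ρ : 0 < 1 - ρ := sub_pos.2 hρ1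
  have hK : 0 ≤ K := by
    have := hγ 0; rw [pow_zero, mul_one] at this; exact (abs_nonneg _).trans this
  have hs' : Summable fun k : ℕ => ((k : ℝ) + 1) * γ (k + 1) := by
    have := summable_succ_mul_of_abs_le_geometric hρ0 hρ1 hγ 0
    simpa using this
  -- split the series at `w`
  have hsplit : ∑' k : ℕ, ((k : ℝ) + 1) * γ (k + 1) - ∑ k ∈ Finset.range w, ((k : ℝ) + 1) * γ (k + 1)
      = ∑' j : ℕ, (((j + w : ℕ) : ℝ) + 1) * γ (j + w + 1) := by
    rw [← hs'.sum_add_tsum_nat_add w, add_sub_cancel_left]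
  have htail : Summable fun j : ℕ => γ (j + w + 1) :=
    (summable_nat_add_iff (f := fun k : ℕ => γ (k + 1)) w).2 (summable_of_abs_le_geometric hρ0 hρ1 hγ 1)
  have hsJ : Summable fun j : ℕ => ((j : ℝ) + 1) * γ (j + w + 1) :=
    summable_succ_mul_of_abs_le_geometric hρ0 hρ1 hγ w
  have h3 : ∑' j, (((j + w : ℕ) : ℝ) + 1) * γ (j + w + 1)
      = ∑' j : ℕ, ((j : ℝ) + 1) * γ (j + w + 1) + w * ∑' j, γ (j + w + 1) := by
    rw [← tsum_mul_left, ← hsJ.tsum_add (htail.mul_left (w : ℝ))]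
    exact tsum_congr fun j => by push_cast; ring
  rw [hsplit, h3]
  have hb1 := abs_tsum_succ_mul_shift_le_of_abs_le_geometric hρ0 hρ1 hγ w
  have hb2 : |∑' j : ℕ, γ (j + w + 1)| ≤ K * ρ ^ (w + 1) / (1 - ρ) := by
    have := abs_tsum_shift_le_of_abs_le_geometric hρ0 hρ1 hγ (w + 1)
    simpa [add_assoc] using this
  have hb2' : |(w : ℝ) * ∑' j : ℕ, γ (j + w + 1)| ≤ w * (K * ρ ^ (w + 1) / (1 - ρ) ^ 2) := by
    rw [abs_mul, abs_of_nonneg (Nat.cast_nonneg w)]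
    refine mul_le_mul_of_nonneg_left (hb2.trans ?_) (Nat.cast_nonneg w)
    rw [div_le_div_iff₀ h1ρ (by positivity)]
    have : (1 - ρ) ^ 2 ≤ (1 - ρ) := by nlinarith
    exact mul_le_mul_of_nonneg_left this (by positivity)
  calc |∑' j : ℕ, ((j : ℝ) + 1) * γ (j + w + 1) + (w : ℝ) * ∑' j : ℕ, γ (j + w + 1)|
      ≤ |∑' j : ℕ, ((j : ℝ) + 1) * γ (j + w + 1)| + |(w : ℝ) * ∑' j : ℕ, γ (j + w + 1)| := abs_add_le _ _
    _ ≤ K * ρ ^ (w + 1) / (1 - ρ) ^ 2 + w * (K * ρ ^ (w + 1) / (1 - ρ) ^ 2) := add_le_add hb1 hb2'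
    _ = K * (w + 1) * ρ ^ (w + 1) / (1 - ρ) ^ 2 := by ring

end Series

section Chain

variable {κ : Kernel Ω Ω} [IsMarkovKernel κ] {π : Measure Ω} [IsProbabilityMeasure π] {A ρ : ℝ}

/-- The sample autocovariance `γ̂_{k,N}` is a measurable function of the path. -/
theorem measurable_sampleAutocovariance {f : Ω → ℝ} (hf : Measurable f) (k N : ℕ) :
    Measurable fun x : ℕ → Ω => (∑ i ∈ Finset.range (N - k),
      (f (x i) - (∑ j ∈ Finset.range N, f (x j)) / N) * (f (x (i + k)) - (∑ j ∈ Finset.range N, f (x j)) / N)) / N := by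
  have hm : Measurable fun x : ℕ → Ω => (∑ j ∈ Finset.range N, f (x j)) / N :=
    (Finset.measurable_sum _ fun j _ => hf.comp (measurable_pi_apply j)).div_const _
  exact (Finset.measurable_sum _ fun i _ =>
    ((hf.comp (measurable_pi_apply i)).sub hm).mul ((hf.comp (measurable_pi_apply (i + k))).sub hm)).div_const _

omit [MeasurableSpace Ω] in
/-- `|γ̂_{k,N}| ≤ 4C²` when `|f| ≤ C`. -/
theorem abs_sampleAutocovariance_le {f : Ω → ℝ} {C : ℝ} (hC : ∀ x, |f x| ≤ C) (k N : ℕ) (x : ℕ → Ω) :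
    |(∑ i ∈ Finset.range (N - k),
      (f (x i) - (∑ j ∈ Finset.range N, f (x j)) / N) * (f (x (i + k)) - (∑ j ∈ Finset.range N, f (x j)) / N)) / N|
      ≤ 4 * C ^ 2 := by
  have hC0 : 0 ≤ C := (abs_nonneg _).trans (hC (x 0))
  rcases Nat.eq_zero_or_pos N with hN | hN
  · subst hN; simp; positivity
  have hNpos : (0 : ℝ) < N := by exact_mod_cast hN
  have hm : |(∑ j ∈ Finset.range N, f (x j)) / N| ≤ C := by
    rw [abs_div, abs_of_pos hNpos, div_le_iff₀ hNpos]
    calc |∑ j ∈ Finset.range N, f (x j)| ≤ ∑ j ∈ Finset.range N, |f (x j)| := Finset.abs_sum_le_sum_abs _ _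
      _ ≤ ∑ _j ∈ Finset.range N, C := Finset.sum_le_sum fun j _ => hC _
      _ = C * N := by rw [Finset.sum_const, Finset.card_range, nsmul_eq_mul, mul_comm]
  have hd : ∀ i, |f (x i) - (∑ j ∈ Finset.range N, f (x j)) / N| ≤ 2 * C := fun i =>
    (abs_sub _ _).trans (by linarith [hC (x i), hm])
  rw [abs_div, abs_of_pos hNpos, div_le_iff₀ hNpos]
  calc |∑ i ∈ Finset.range (N - k), (f (x i) - (∑ j ∈ Finset.range N, f (x j)) / N)
          * (f (x (i + k)) - (∑ j ∈ Finset.range N, f (x j)) / N)|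
      ≤ ∑ i ∈ Finset.range (N - k), |(f (x i) - (∑ j ∈ Finset.range N, f (x j)) / N)
          * (f (x (i + k)) - (∑ j ∈ Finset.range N, f (x j)) / N)| := Finset.abs_sum_le_sum_abs _ _
    _ ≤ ∑ _i ∈ Finset.range (N - k), 2 * C * (2 * C) := Finset.sum_le_sum fun i _ => by
        rw [abs_mul]; exact mul_le_mul (hd _) (hd _) (abs_nonneg _) (by positivity)
    _ = ((N - k : ℕ) : ℝ) * (2 * C * (2 * C)) := by rw [Finset.sum_const, Finset.card_range, nsmul_eq_mul]
    _ ≤ N * (2 * C * (2 * C)) := by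
        refine mul_le_mul_of_nonneg_right ?_ (by positivity)
        exact_mod_cast Nat.sub_le N k
    _ = 4 * C ^ 2 * N := by ring

/-- **THE PLUG-IN ESTIMATOR OF THE LEADING BIAS CONSTANT CONVERGES FROM ANY START.**  Envelope
`(A, ρ)` (`0 ≤ A`, `0 ≤ ρ < 1`), `π` invariant is not needed, `|f| ≤ C` measurable,
`γ_k = autocov κ π f̄ k`, `Γ_f = Σ' k, (k+1) γ_{k+1}`; for every initial law, every window `w` and
run length `N` with `2w ≤ N`, `0 < N`:
`E_{μ₀} |Σ_{k<w} (k+1) γ̂_{k+1,N} − Γ_f| ≤ w² ε(w,N) + 8C²A (w+1) ρ^{w+1}/(1−ρ)²` with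
`ε(w,N) = √2·8C²(√(2w+1) + 2√10·A/(1−ρ))/√N + 4C²w/N + 4C·(√10·4CA/(1−ρ))/√N + 10(4CA/(1−ρ))²/N`. -/
theorem chain_leadingBiasEstimator_abs_sub_le_of_envelope
    (henv : ∀ (g : Ω → ℝ), Measurable g → ∀ (Cg : ℝ), (∀ x, |g x| ≤ Cg) →
      ∀ (t : ℕ) (x : Ω), |(kop κ)^[t] g x - ∫ y, g y ∂π| ≤ 2 * Cg * (A * ρ ^ t))
    (hA : 0 ≤ A) (hρ0 : 0 ≤ ρ) (hρ1 : ρ < 1) {f : Ω → ℝ} (hf : Measurable f) {C : ℝ} (hC : ∀ x, |f x| ≤ C)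
    (μ₀ : Measure Ω) [IsProbabilityMeasure μ₀] {w N : ℕ} (hwN : 2 * w ≤ N) (hN : 0 < N) :
    ∫ x, |(∑ k ∈ Finset.range w, ((k : ℝ) + 1) *
            ((∑ i ∈ Finset.range (N - (k + 1)), (f (x i) - (∑ j ∈ Finset.range N, f (x j)) / N)
              * (f (x (i + (k + 1))) - (∑ j ∈ Finset.range N, f (x j)) / N)) / N))
          - ∑' k : ℕ, ((k : ℝ) + 1) * autocov κ π (fun y => f y - ∫ z, f z ∂π) (k + 1)|
        ∂(Kernel.trajMeasure (X := fun _ : ℕ => Ω) (μ₀)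
          (fun n : ℕ => κ.comap (fun h' : (i : ↥(Finset.Iic n)) → Ω => h' ⟨n, Finset.mem_Iic.2 le_rfl⟩)
            (measurable_pi_apply _)))
      ≤ (w : ℝ) ^ 2 * (Real.sqrt 2 * (8 * C ^ 2 * (Real.sqrt (2 * w + 1) + 2 * Real.sqrt 10 * A / (1 - ρ)))
              / Real.sqrt N
            + 4 * C ^ 2 * w / N + 4 * C * (Real.sqrt 10 * (4 * C * A / (1 - ρ))) / Real.sqrt N
            + 10 * (4 * C * A / (1 - ρ)) ^ 2 / N)
        + 8 * C ^ 2 * A * (w + 1) * ρ ^ (w + 1) / (1 - ρ) ^ 2 := by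
  set P := (Kernel.trajMeasure (X := fun _ : ℕ => Ω) (μ₀)
        (fun n : ℕ => κ.comap (fun h' : (i : ↥(Finset.Iic n)) → Ω => h' ⟨n, Finset.mem_Iic.2 le_rfl⟩)
          (measurable_pi_apply _))) with hP
  have hC0 : 0 ≤ C := (abs_nonneg _).trans (hC (Classical.choice (nonempty_of_isProbabilityMeasure μ₀)))
  have h1ρ : 0 < 1 - ρ := sub_pos.2 hρ1
  have hNpos : (0 : ℝ) < N := by exact_mod_cast hN
  have hN0 : N ≠ 0 := by omega
  obtain ⟨hfb, hCfb, hfb0⟩ := centred_observable_bounds π hf hC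
  -- the autocovariances decay geometrically: `|γ_k| ≤ 8C²A ρ^k`
  set γ : ℕ → ℝ := fun k => autocov κ π (fun y => f y - ∫ z, f z ∂π) k with hγdef
  have hdec : ∀ t y, |(kop κ)^[t] (fun y => f y - ∫ z, f z ∂π) y| ≤ 2 * (2 * C) * (A * ρ ^ t) :=
    decay_of_geometricEnvelope henv _ hfb (2 * C) hCfb hfb0
  have hγ : ∀ k, |γ k| ≤ 8 * C ^ 2 * A * ρ ^ k := fun k => by
    have := Exactness.GeneralNCMC.abs_autocov_le_of_envelope (κ := κ) (π := π) hCfb hdec k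
    refine this.trans (le_of_eq ?_); ring
  -- the estimator, term by term
  set G : ℕ → (ℕ → Ω) → ℝ := fun k x => (∑ i ∈ Finset.range (N - (k + 1)),
      (f (x i) - (∑ j ∈ Finset.range N, f (x j)) / N) * (f (x (i + (k + 1))) - (∑ j ∈ Finset.range N, f (x j)) / N)) / N
    with hG
  have hGm : ∀ k, Measurable (G k) := fun k => measurable_sampleAutocovariance hf (k + 1) N
  have hGb : ∀ k x, |G k x| ≤ 4 * C ^ 2 := fun k x => abs_sampleAutocovariance_le hC (k + 1) N x
  set Γ : ℝ := ∑' k : ℕ, ((k : ℝ) + 1) * γ (k + 1) with hΓ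
  set T : ℝ := Γ - ∑ k ∈ Finset.range w, ((k : ℝ) + 1) * γ (k + 1) with hT
  have hTb : |T| ≤ 8 * C ^ 2 * A * (w + 1) * ρ ^ (w + 1) / (1 - ρ) ^ 2 :=
    abs_leadingBias_tail_le hρ0 hρ1 hγ w
  -- pathwise: `Γ̂ − Γ = Σ_{k<w} (k+1)(G_k − γ_{k+1}) − T`
  have hpt : ∀ x : ℕ → Ω, (∑ k ∈ Finset.range w, ((k : ℝ) + 1) * G k x) - Γ
      = (∑ k ∈ Finset.range w, ((k : ℝ) + 1) * (G k x - γ (k + 1))) - T := by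
    intro x
    rw [hT]
    simp only [mul_sub, Finset.sum_sub_distrib]
    ring
  have hbd : ∀ x : ℕ → Ω, |(∑ k ∈ Finset.range w, ((k : ℝ) + 1) * G k x) - Γ|
      ≤ (∑ k ∈ Finset.range w, ((k : ℝ) + 1) * |G k x - γ (k + 1)|) + |T| := by
    intro x
    rw [hpt x]
    refine (abs_sub _ _).trans (add_le_add ((Finset.abs_sum_le_sum_abs _ _).trans
      (Finset.sum_le_sum fun k _ => ?_)) le_rfl)
    rw [abs_mul, abs_of_nonneg (by positivity : (0 : ℝ) ≤ (k : ℝ) + 1)]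
  -- integrability
  have hIk : ∀ k : ℕ, Integrable (fun x => ((k : ℝ) + 1) * |G k x - γ (k + 1)|) P := fun k =>
    ((integrable_of_bounded P (hGm k) (hGb k)).sub (integrable_const _)).abs.const_mul _
  have hIsum : Integrable (fun x => (∑ k ∈ Finset.range w, ((k : ℝ) + 1) * |G k x - γ (k + 1)|) + |T|) P :=
    (integrable_finsetSum _ fun k _ => hIk k).add (integrable_const _)
  -- per-lag bound, uniform in `k < w`
  set ε : ℝ := Real.sqrt 2 * (8 * C ^ 2 * (Real.sqrt (2 * w + 1) + 2 * Real.sqrt 10 * A / (1 - ρ))) / Real.sqrt N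
      + 4 * C ^ 2 * w / N + 4 * C * (Real.sqrt 10 * (4 * C * A / (1 - ρ))) / Real.sqrt N
      + 10 * (4 * C * A / (1 - ρ)) ^ 2 / N with hε
  have hk : ∀ k ∈ Finset.range w, ∫ x, |G k x - γ (k + 1)| ∂P ≤ ε := by
    intro k hkw
    have hkw' : k + 1 ≤ w := Finset.mem_range.1 hkw
    have hk1N : k + 1 < N := by omega
    have h2 := chain_sampleAutocovariance_abs_sub_le_of_envelope (κ := κ) henv hA hρ0 hρ1 hf hC μ₀ hk1N
    rw [← hP] at h2
    refine h2.trans ?_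
    -- compare the four terms
    have hM : (0 : ℝ) < ((N - (k + 1) : ℕ) : ℝ) := by exact_mod_cast (show 0 < N - (k + 1) by omega)
    have hMge : (N : ℝ) / 2 ≤ ((N - (k + 1) : ℕ) : ℝ) := by
      rw [Nat.cast_sub hk1N.le]; push_cast
      have : ((2 * w : ℕ) : ℝ) ≤ N := by exact_mod_cast hwN
      push_cast at this
      have hkw'' : ((k : ℝ) + 1) ≤ w := by exact_mod_cast hkw'
      linarith
    have hR : 8 * C ^ 2 * (Real.sqrt (2 * (↑(k + 1) : ℝ) + 1) + 2 * Real.sqrt 10 * A / (1 - ρ))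
        ≤ 8 * C ^ 2 * (Real.sqrt (2 * w + 1) + 2 * Real.sqrt 10 * A / (1 - ρ)) := by
      refine mul_le_mul_of_nonneg_left (add_le_add (Real.sqrt_le_sqrt ?_) le_rfl) (by positivity)
      have : ((k + 1 : ℕ) : ℝ) ≤ w := by exact_mod_cast hkw'
      linarith
    have hRpos : 0 ≤ 8 * C ^ 2 * (Real.sqrt (2 * w + 1) + 2 * Real.sqrt 10 * A / (1 - ρ)) := by positivity
    have hsq : 1 / Real.sqrt ((N - (k + 1) : ℕ) : ℝ) ≤ Real.sqrt 2 / Real.sqrt N := by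
      rw [div_le_div_iff₀ (Real.sqrt_pos.2 hM) (Real.sqrt_pos.2 hNpos), one_mul]
      rw [← Real.sqrt_mul (by norm_num : (0:ℝ) ≤ 2)]
      exact Real.sqrt_le_sqrt (by linarith)
    have t1 : 8 * C ^ 2 * (Real.sqrt (2 * (↑(k + 1) : ℝ) + 1) + 2 * Real.sqrt 10 * A / (1 - ρ))
          / Real.sqrt ((N - (k + 1) : ℕ) : ℝ)
        ≤ Real.sqrt 2 * (8 * C ^ 2 * (Real.sqrt (2 * w + 1) + 2 * Real.sqrt 10 * A / (1 - ρ))) / Real.sqrt N := by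
      calc 8 * C ^ 2 * (Real.sqrt (2 * (↑(k + 1) : ℝ) + 1) + 2 * Real.sqrt 10 * A / (1 - ρ))
            / Real.sqrt ((N - (k + 1) : ℕ) : ℝ)
          ≤ 8 * C ^ 2 * (Real.sqrt (2 * w + 1) + 2 * Real.sqrt 10 * A / (1 - ρ)) / Real.sqrt ((N - (k + 1) : ℕ) : ℝ) :=
            div_le_div_of_nonneg_right hR (Real.sqrt_nonneg _)
        _ = 8 * C ^ 2 * (Real.sqrt (2 * w + 1) + 2 * Real.sqrt 10 * A / (1 - ρ)) * (1 / Real.sqrt ((N - (k + 1) : ℕ) : ℝ)) := by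
            rw [mul_one_div]
        _ ≤ 8 * C ^ 2 * (Real.sqrt (2 * w + 1) + 2 * Real.sqrt 10 * A / (1 - ρ)) * (Real.sqrt 2 / Real.sqrt N) :=
            mul_le_mul_of_nonneg_left hsq hRpos
        _ = Real.sqrt 2 * (8 * C ^ 2 * (Real.sqrt (2 * w + 1) + 2 * Real.sqrt 10 * A / (1 - ρ))) / Real.sqrt N := by
            ring
    have t2 : 4 * C ^ 2 * ((k + 1 : ℕ) : ℝ) / N ≤ 4 * C ^ 2 * w / N := by
      refine div_le_div_of_nonneg_right (mul_le_mul_of_nonneg_left ?_ (by positivity)) hNpos.le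
      exact_mod_cast hkw'
    rw [hε]
    linarith [t1, t2]
  -- assemble
  have hGsum : ∀ x : ℕ → Ω, (∑ k ∈ Finset.range w, ((k : ℝ) + 1) *
        ((∑ i ∈ Finset.range (N - (k + 1)), (f (x i) - (∑ j ∈ Finset.range N, f (x j)) / N)
          * (f (x (i + (k + 1))) - (∑ j ∈ Finset.range N, f (x j)) / N)) / N))
      = ∑ k ∈ Finset.range w, ((k : ℝ) + 1) * G k x := fun x => rfl
  have step1 : ∫ x, |(∑ k ∈ Finset.range w, ((k : ℝ) + 1) * G k x) - Γ| ∂P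
      ≤ ∫ x, ((∑ k ∈ Finset.range w, ((k : ℝ) + 1) * |G k x - γ (k + 1)|) + |T|) ∂P :=
    integral_mono_of_nonneg (ae_of_all _ fun x => abs_nonneg _) hIsum (ae_of_all _ hbd)
  have step2 : ∫ x, ((∑ k ∈ Finset.range w, ((k : ℝ) + 1) * |G k x - γ (k + 1)|) + |T|) ∂P
      = (∑ k ∈ Finset.range w, ((k : ℝ) + 1) * ∫ x, |G k x - γ (k + 1)| ∂P) + |T| := by
    rw [integral_add (integrable_finsetSum _ fun k _ => hIk k) (integrable_const _), integral_const,
      probReal_univ, one_smul, integral_finsetSum _ fun k _ => hIk k]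
    congr 1
    exact Finset.sum_congr rfl fun k _ => integral_const_mul _ _
  have step3 : (∑ k ∈ Finset.range w, ((k : ℝ) + 1) * ∫ x, |G k x - γ (k + 1)| ∂P) ≤ (w : ℝ) ^ 2 * ε := by
    calc (∑ k ∈ Finset.range w, ((k : ℝ) + 1) * ∫ x, |G k x - γ (k + 1)| ∂P)
        ≤ ∑ k ∈ Finset.range w, ((k : ℝ) + 1) * ε :=
          Finset.sum_le_sum fun k hkw => mul_le_mul_of_nonneg_left (hk k hkw) (by positivity)
      _ ≤ ∑ _k ∈ Finset.range w, (w : ℝ) * ε := Finset.sum_le_sum fun k hkw => by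
          have hε0 : 0 ≤ ε := (integral_nonneg fun x => abs_nonneg _).trans (hk k hkw)
          refine mul_le_mul_of_nonneg_right ?_ hε0
          have : k + 1 ≤ w := Finset.mem_range.1 hkw
          exact_mod_cast this
      _ = (w : ℝ) ^ 2 * ε := by rw [Finset.sum_const, Finset.card_range, nsmul_eq_mul]; ring
  simp_rw [hGsum]
  linarith [step1, step2, step3, hTb]

end Chain

end Summit.Ventures.LatticeQCDFlow.Scoring

end
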